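import Literature.Probability.Process.LocalRubberCompact
import Literature.Geometry.DiscreteGeometry.KissingPatterns
import Summits.AtomisticToContinuum.Crystallization.Theorems.PalmUnimodularRigidityChargedPatternCrystallizes

/-!
# Crux `GappedShellCensus.CleanLimitExtractionR` (stmt-AtomisticToContinuum-18072), line
# `CleanLimitExtractionR_CandidateProof` — stub B `stub_cleRFccHcpOfTendsto`

THE fcc/hcp TYPING OF SHELLS IS CLOSED under local-rubber limits of `δ`-separated configurations.
Setting as in stub A (`S k → Y` in `LocalConfig ℝ³`, all `δ`-separated, `y ∈ Y`, `‖y‖ < r`), now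
with every site of `S k` in `B̄(0, r)` eventually CLEAN at scale `a` (gapped-twelve AND rescaled bond
shell `1/5`-close, after a linear isometry, to `fccKissingPattern` or `hcpKissingPattern`), and with
`y` already gapped-twelve in `Y` (the output of stub A, taken as a hypothesis so that the two stubs
are independent).  Conclusion: the rescaled shell of `y` in `Y` is `1/5`-close to fcc or hcp.

Proof.  `cleR_stage_labelling` (finite, one matching): from a clean stage site `p` near `y`, an
injective labelling of the LIMIT shell by the stage's pattern at tolerance `1/5 + 2η/a` (pattern
point ↦ stage shell point ↦ its matching partner in `Y`, which lies in the shell of `y` by the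
collar argument ↦ rescaled about `y`).  `cleR_shellCloseTo_of_frequently` (compactness): if such
labellings by a FIXED pattern occur frequently with tolerances `1/5 + ε n`, `ε n → 0`, then
`ShellCloseTo (1/5)` holds — pigeonhole on the finitely many labellings
(`exists_frequently_eq_of_forall_mem`), sequential compactness of `O(3)`
(`exists_subseq_tendsto_linearIsometry`), closedness of `≤`.  One of the two patterns occurs
frequently.
Ported from the checked crux workfile `Cruxes/CleanLimitExtractionR/SketchIdeator2.lean` (crux-ideate,
ideator 2; farm rc 0, H21 audit `proof-of-item closed:true`); the route's clauses (gapped-twelve,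
fcc/hcp-typed shell, clean site) are written out verbatim — no definitions, no notations.
-/

noncomputable section

namespace Summit.AtomisticToContinuum.Crystallization.Theorems

open Filter Topology Set
open scoped Classical
open Literature.Probability.Process Literature.Geometry.DiscreteGeometry

/-- Finite-dimensional compactness step, pattern fixed: if injective labellings `g : P → T` with
isometries `A_n` at tolerance `1/5 + ε n` occur frequently and `ε n → 0`, then
`ShellCloseTo (1/5) T P` — pigeonhole on the finitely many `g` (`exists_frequently_eq_of_forall_mem`),
sequential compactness of `O(3)` (`exists_subseq_tendsto_linearIsometry`), closedness of `≤`; the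
`Equiv` of `ShellCloseTo` is assembled at the end. -/
theorem cleR_shellCloseTo_of_frequently {T P : Finset (EuclideanSpace ℝ (Fin 3))} (hcard : T.card = P.card) {ε : ℕ → ℝ}
    (hε : Tendsto ε atTop (𝓝 0))
    (h : ∃ᶠ n in atTop, ∃ (g : ↥P → ↥T) (A : EuclideanSpace ℝ (Fin 3) →ₗᵢ[ℝ] (EuclideanSpace ℝ (Fin 3))),
      Function.Injective g ∧ ∀ v : ↥P, dist ((g v : ↥T) : EuclideanSpace ℝ (Fin 3)) (A v) ≤ 1 / 5 + ε n) :
    ShellCloseTo (1 / 5) T P := by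
  classical
  obtain ⟨ψ₀, hψ₀, hall⟩ := extraction_of_frequently_atTop h
  choose g A hginj hdist using hall
  obtain ⟨g₀, -, hfreq⟩ :=
    Summit.AtomisticToContinuum.Crystallization.Theorems.exists_frequently_eq_of_forall_mem
      (F := Finset.univ) (y := g) fun k => Finset.mem_univ _
  obtain ⟨ψ₁, hψ₁, hg₀⟩ := extraction_of_frequently_atTop hfreq
  obtain ⟨ψ₂, hψ₂, B, hB⟩ :=
    Summit.AtomisticToContinuum.Crystallization.Theorems.exists_subseq_tendsto_linearIsometry
      fun k => A (ψ₁ k)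
  have hg₀inj : Function.Injective g₀ := by
    rw [← hg₀ 0]
    exact hginj _
  have hg₀bij : Function.Bijective g₀ := by
    rw [Fintype.bijective_iff_injective_and_card]
    refine ⟨hg₀inj, ?_⟩
    simp only [Fintype.card_coe]
    exact hcard.symm
  -- the displacement bound passes to the limit isometry
  have hlim : ∀ v : ↥P, dist ((g₀ v : ↥T) : EuclideanSpace ℝ (Fin 3)) (B v) ≤ 1 / 5 := by
    intro v
    have hA : Tendsto (fun k => A (ψ₁ (ψ₂ k)) v) atTop (𝓝 (B v)) := by
      have h1 : Tendsto (fun k => (A (ψ₁ (ψ₂ k))).toContinuousLinearMap) atTop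
          (𝓝 B.toContinuousLinearMap) := hB
      exact ((ContinuousLinearMap.apply ℝ (EuclideanSpace ℝ (Fin 3)) (v : EuclideanSpace ℝ (Fin 3))).continuous.tendsto _).comp h1
    have hL : Tendsto (fun k => dist ((g₀ v : ↥T) : EuclideanSpace ℝ (Fin 3)) (A (ψ₁ (ψ₂ k)) v)) atTop
        (𝓝 (dist ((g₀ v : ↥T) : EuclideanSpace ℝ (Fin 3)) (B v))) := tendsto_const_nhds.dist hA
    have hR : Tendsto (fun k => 1 / 5 + ε (ψ₀ (ψ₁ (ψ₂ k)))) atTop (𝓝 (1 / 5 + 0)) :=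
      tendsto_const_nhds.add (hε.comp ((hψ₀.comp (hψ₁.comp hψ₂)).tendsto_atTop))
    rw [add_zero] at hR
    refine le_of_tendsto_of_tendsto' hL hR fun k => ?_
    have := hdist (ψ₁ (ψ₂ k)) v
    rw [hg₀ (ψ₂ k)] at this
    exact this
  -- assemble the matching `T ≃ P.image B`
  set eP : ↥P ≃ ↥T := Equiv.ofBijective g₀ hg₀bij with heP
  have hBmem : ∀ v : ↥P, B v ∈ P.image B := fun v => Finset.mem_image_of_mem _ v.2
  set fB : ↥P → ↥(P.image B) := fun v => ⟨B v, hBmem v⟩ with hfB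
  have hfBbij : Function.Bijective fB := by
    constructor
    · intro v v' hvv'
      have : (B v : EuclideanSpace ℝ (Fin 3)) = B v' := congrArg Subtype.val hvv'
      exact Subtype.ext (B.injective this)
    · rintro ⟨q, hq⟩
      obtain ⟨v, hv, rfl⟩ := Finset.mem_image.1 hq
      exact ⟨⟨v, hv⟩, rfl⟩
  set eB : ↥P ≃ ↥(P.image B) := Equiv.ofBijective fB hfBbij with heB
  refine ⟨B, eP.symm.trans eB, fun t => ?_⟩
  have hgt : g₀ (eP.symm t) = t := eP.apply_symm_apply t
  have h1 := hlim (eP.symm t)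
  rw [hgt] at h1
  exact h1

/-- STAGE LABELLING (finite, one matching): from a clean stage site `p` near the limit site `y`,
an injective labelling of the LIMIT shell (rescaled, as the Finset `T`) by the stage's pattern `P`,
at tolerance `1/5 + 2η/a`: pattern point `v` ↦ stage shell point (via the stage's `ShellCloseTo`
equivalence) ↦ its partner in `Y` (fine matching; it lies in the shell of `y` by the collar
argument) ↦ rescaled about `y`. -/
theorem cleR_stage_labelling {S Y : Set (EuclideanSpace ℝ (Fin 3))} {a δ η R : ℝ} (ha : 0 < a) (_hδ : 0 < δ) (_hη : 0 ≤ η)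
    (h2η : 2 * η < δ) (hηa : 25 * η < a) (_hη1 : η ≤ 1)
    (hS : ∀ u ∈ S, ∀ v ∈ S, u ≠ v → δ ≤ dist u v)
    (hm : LocallyMatches R η Y S) {p y : EuclideanSpace ℝ (Fin 3)} (_hp : p ∈ S) (hyp : dist y p ≤ η)
    (hR : ‖y‖ + 1 + 2 * a ≤ R) (hg : ({w ∈ S | w ≠ p ∧ dist p w ≤ a * (1 + 1 / 50)}.ncard = 12 ∧
          ∀ w ∈ S, w ≠ p → a * (1 - 1 / 50) ≤ dist p w ∧
            (dist p w ≤ a * (1 + 1 / 50) ∨ a * (63 / 50) ≤ dist p w)))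
    (hrad : ∀ w ∈ Y, w ≠ y → a * (1 - 1 / 50) ≤ dist y w ∧
      (dist y w ≤ a * (1 + 1 / 50) ∨ a * (63 / 50) ≤ dist y w))
    {T Tk P : Finset (EuclideanSpace ℝ (Fin 3))}
    (hT : (↑T : Set (EuclideanSpace ℝ (Fin 3))) = (fun w => a⁻¹ • (w - y)) '' {w ∈ Y | w ≠ y ∧ dist y w ≤ a * (1 + 1 / 50)})
    (hTk : (↑Tk : Set (EuclideanSpace ℝ (Fin 3))) = (fun w => a⁻¹ • (w - p)) '' {w ∈ S | w ≠ p ∧ dist p w ≤ a * (1 + 1 / 50)})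
    (hclose : ShellCloseTo (1 / 5) Tk P) :
    ∃ (g : ↥P → ↥T) (A : EuclideanSpace ℝ (Fin 3) →ₗᵢ[ℝ] (EuclideanSpace ℝ (Fin 3))), Function.Injective g ∧
      ∀ v : ↥P, dist ((g v : ↥T) : EuclideanSpace ℝ (Fin 3)) (A v) ≤ 1 / 5 + 2 * η / a := by
  classical
  obtain ⟨A, e, he⟩ := hclose
  have hAmem : ∀ v : ↥P, A v ∈ P.image A := fun v => Finset.mem_image_of_mem _ v.2
  -- the stage shell point labelled by `v`
  have H1 : ∀ v : ↥P, ∃ wk : EuclideanSpace ℝ (Fin 3), (wk ∈ S ∧ wk ≠ p ∧ dist p wk ≤ a * (1 + 1 / 50)) ∧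
      a⁻¹ • (wk - p) = ((e.symm ⟨A v, hAmem v⟩ : ↥Tk) : EuclideanSpace ℝ (Fin 3)) := by
    intro v
    have hmem : ((e.symm ⟨A v, hAmem v⟩ : ↥Tk) : EuclideanSpace ℝ (Fin 3)) ∈ (↑Tk : Set (EuclideanSpace ℝ (Fin 3))) :=
      (e.symm ⟨A v, hAmem v⟩).2
    rw [hTk] at hmem
    obtain ⟨wk, hwk, hwk_eq⟩ := hmem
    exact ⟨wk, hwk, hwk_eq⟩
  choose wk hwk hwk_eq using H1
  have hlowk : ∀ v, a * (1 - 1 / 50) ≤ dist p (wk v) := fun v =>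
    (hg.2 (wk v) (hwk v).1 (hwk v).2.1).1
  -- its partner in `Y`
  have H2 : ∀ v : ↥P, ∃ w ∈ Y, dist w (wk v) ≤ η := by
    intro v
    refine hm.1 (wk v) (hwk v).1 ?_
    have h1 := norm_sub_norm_le (wk v) p
    rw [← dist_eq_norm, dist_comm] at h1
    have h2 := norm_sub_norm_le p y
    rw [← dist_eq_norm, dist_comm] at h2
    nlinarith [(hwk v).2.2, ha]
  choose w hwY hw_dist using H2
  -- the partner lies in the shell of `y` (collar argument)
  have hw_ne : ∀ v, w v ≠ y := by
    intro v h
    have h1 : dist y (wk v) ≤ η := by rw [← h]; exact hw_dist v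
    have h2 : dist p (wk v) ≤ dist p y + dist y (wk v) := dist_triangle _ _ _
    rw [dist_comm p y] at h2
    nlinarith [hlowk v, ha]
  have hw_sh : ∀ v, dist y (w v) ≤ a * (1 + 1 / 50) := by
    intro v
    have hup : dist y (w v) ≤ a * (1 + 1 / 50) + 2 * η :=
      calc dist y (w v) ≤ dist y p + dist p (w v) := dist_triangle _ _ _
        _ ≤ dist y p + (dist p (wk v) + dist (wk v) (w v)) := by gcongr; exact dist_triangle _ _ _
        _ ≤ η + (a * (1 + 1 / 50) + η) := by
            gcongr
            · exact (hwk v).2.2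
            · rw [dist_comm]; exact hw_dist v
        _ = a * (1 + 1 / 50) + 2 * η := by ring
    rcases (hrad (w v) (hwY v) (hw_ne v)).2 with h | h
    · exact h
    · exfalso; nlinarith [ha]
  -- the labelling
  have hgmem : ∀ v : ↥P, a⁻¹ • (w v - y) ∈ T := by
    intro v
    rw [← Finset.mem_coe, hT]
    exact ⟨w v, ⟨hwY v, hw_ne v, hw_sh v⟩, rfl⟩
  refine ⟨fun v => ⟨a⁻¹ • (w v - y), hgmem v⟩, A, ?_, ?_⟩
  · intro v v' hvv'
    have h1 : a⁻¹ • (w v - y) = a⁻¹ • (w v' - y) := congrArg Subtype.val hvv'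
    have h2 : w v = w v' :=
      sub_left_injective (smul_right_injective (EuclideanSpace ℝ (Fin 3)) (inv_ne_zero ha.ne') h1)
    have h3 : wk v = wk v' := by
      by_contra hne
      have hsep := hS _ (hwk v).1 _ (hwk v').1 hne
      have : dist (wk v) (wk v') ≤ 2 * η :=
        calc dist (wk v) (wk v') ≤ dist (w v) (wk v) + dist (w v) (wk v') := dist_triangle_left _ _ _
          _ ≤ η + η := by
              gcongr
              · exact hw_dist v
              · rw [h2]; exact hw_dist v'
          _ = 2 * η := by ring
      linarith
    have h4 : (e.symm ⟨A v, hAmem v⟩ : ↥Tk) = e.symm ⟨A v', hAmem v'⟩ := by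
      apply Subtype.ext
      rw [← hwk_eq v, ← hwk_eq v', h3]
    have h5 := e.symm.injective h4
    have h6 : A v = A v' := congrArg Subtype.val h5
    exact Subtype.ext (A.injective h6)
  · intro v
    show dist (a⁻¹ • (w v - y)) (A v) ≤ 1 / 5 + 2 * η / a
    have hd1 : dist (a⁻¹ • (w v - y)) (a⁻¹ • (wk v - p)) ≤ 2 * η / a := by
      rw [dist_smul₀, norm_inv, Real.norm_of_nonneg ha.le, dist_eq_norm]
      have hnum : ‖(w v - y) - (wk v - p)‖ ≤ 2 * η := by
        have hrew : (w v - y) - (wk v - p) = (w v - wk v) + (p - y) := by abel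
        rw [hrew]
        have ha1 : ‖w v - wk v‖ ≤ η := by rw [← dist_eq_norm]; exact hw_dist v
        have ha2 : ‖p - y‖ ≤ η := by rw [← dist_eq_norm, dist_comm]; exact hyp
        calc ‖(w v - wk v) + (p - y)‖ ≤ ‖w v - wk v‖ + ‖p - y‖ := norm_add_le _ _
          _ ≤ η + η := add_le_add ha1 ha2
          _ = 2 * η := by ring
      calc a⁻¹ * ‖(w v - y) - (wk v - p)‖ ≤ a⁻¹ * (2 * η) := by gcongr
        _ = 2 * η / a := by ring
    have hd2 : dist (a⁻¹ • (wk v - p)) (A v) ≤ 1 / 5 := by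
      rw [hwk_eq v]
      have := he (e.symm ⟨A v, hAmem v⟩)
      rwa [Equiv.apply_symm_apply] at this
    calc dist (a⁻¹ • (w v - y)) (A v)
        ≤ dist (a⁻¹ • (w v - y)) (a⁻¹ • (wk v - p)) + dist (a⁻¹ • (wk v - p)) (A v) :=
          dist_triangle _ _ _
      _ ≤ 2 * η / a + 1 / 5 := add_le_add hd1 hd2
      _ = 1 / 5 + 2 * η / a := by ring

/-- **Stub B — THE fcc/hcp TYPING IS CLOSED under local-rubber limits** of `δ`-separated
configurations (sitewise, with radius loss): if eventually every site of `S k` in `B̄(0, r)` is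
CLEAN (gapped-twelve with `1/5`-fcc/hcp-close rescaled shell), `S k → Y`, `y ∈ Y`, `‖y‖ < r`, and
`y` is already known to be gapped-twelve in `Y` (stub A), then the rescaled shell of `y` in `Y` is
`1/5`-close to fcc or hcp.  The twelve shell points converge (collar transfer gives the
bijections, `cleR_stage_labelling`), one of the finitely many labellings `pattern → shell` recurs
(pigeonhole), the isometries converge along a subsequence (compactness of `O(3)`), and `≤ 1/5`
passes to the limit (`cleR_shellCloseTo_of_frequently`). -/
theorem stub_cleRFccHcpOfTendsto {S : ℕ → LocalConfig (EuclideanSpace ℝ (Fin 3))} {Y : LocalConfig (EuclideanSpace ℝ (Fin 3))} {a δ : ℝ}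
    (ha : 0 < a) (hδ : 0 < δ) (hS : ∀ k, ∀ u ∈ S k, ∀ v ∈ S k, u ≠ v → δ ≤ dist u v)
    (hY : Tendsto S atTop (𝓝 Y)) {y : EuclideanSpace ℝ (Fin 3)} {r : ℝ} (hy : y ∈ Y) (hyr : ‖y‖ < r)
    (hgood : ∀ᶠ k in atTop, ∀ p ∈ S k, ‖p‖ ≤ r →
      (({w ∈ (S k : Set (EuclideanSpace ℝ (Fin 3))) | w ≠ p ∧ dist p w ≤ a * (1 + 1 / 50)}.ncard = 12 ∧
            ∀ w ∈ (S k : Set (EuclideanSpace ℝ (Fin 3))), w ≠ p → a * (1 - 1 / 50) ≤ dist p w ∧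
              (dist p w ≤ a * (1 + 1 / 50) ∨ a * (63 / 50) ≤ dist p w)) ∧
          (∃ T : Finset (EuclideanSpace ℝ (Fin 3)), (↑T : Set (EuclideanSpace ℝ (Fin 3))) =
              (fun w => a⁻¹ • (w - p)) '' {w ∈ (S k : Set (EuclideanSpace ℝ (Fin 3))) | w ≠ p ∧ dist p w ≤ a * (1 + 1 / 50)} ∧
            (ShellCloseTo (1 / 5) T fccKissingPattern ∨ ShellCloseTo (1 / 5) T hcpKissingPattern))))
    (hGY : ({w ∈ (Y : Set (EuclideanSpace ℝ (Fin 3))) | w ≠ y ∧ dist y w ≤ a * (1 + 1 / 50)}.ncard = 12 ∧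
          ∀ w ∈ (Y : Set (EuclideanSpace ℝ (Fin 3))), w ≠ y → a * (1 - 1 / 50) ≤ dist y w ∧
            (dist y w ≤ a * (1 + 1 / 50) ∨ a * (63 / 50) ≤ dist y w))) :
    (∃ T : Finset (EuclideanSpace ℝ (Fin 3)), (↑T : Set (EuclideanSpace ℝ (Fin 3))) =
            (fun w => a⁻¹ • (w - y)) '' {w ∈ (Y : Set (EuclideanSpace ℝ (Fin 3))) | w ≠ y ∧ dist y w ≤ a * (1 + 1 / 50)} ∧
          (ShellCloseTo (1 / 5) T fccKissingPattern ∨ ShellCloseTo (1 / 5) T hcpKissingPattern)) := by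
  classical
  have hrad := hGY.2
  -- the limit shell as a `Finset` of twelve points
  have hfin : {w ∈ (Y : Set (EuclideanSpace ℝ (Fin 3))) | w ≠ y ∧ dist y w ≤ a * (1 + 1 / 50)}.Finite :=
    Set.finite_of_ncard_ne_zero (by rw [hGY.1]; norm_num)
  have hfinT := hfin.image (fun w => a⁻¹ • (w - y))
  have hresc_inj : Function.Injective fun w : EuclideanSpace ℝ (Fin 3) => a⁻¹ • (w - y) := fun u v huv =>
    sub_left_injective (smul_right_injective (EuclideanSpace ℝ (Fin 3)) (inv_ne_zero ha.ne') huv)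
  have hT : (↑hfinT.toFinset : Set (EuclideanSpace ℝ (Fin 3))) =
      (fun w => a⁻¹ • (w - y)) '' {w ∈ (Y : Set (EuclideanSpace ℝ (Fin 3))) | w ≠ y ∧ dist y w ≤ a * (1 + 1 / 50)} :=
    hfinT.coe_toFinset
  have hTcard : hfinT.toFinset.card = 12 := by
    rw [← Set.ncard_coe_finset, hT, Set.ncard_image_of_injective _ hresc_inj, hGY.1]
  refine ⟨hfinT.toFinset, hT, ?_⟩
  -- matching scales `ηs n → 0`
  have hr : 0 < r - ‖y‖ := by linarith
  set η₀ : ℝ := min (δ / 4) (min (a / 50) (min ((r - ‖y‖) / 2) 1)) with hη₀_def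
  have hη₀ : 0 < η₀ := lt_min (by positivity) (lt_min (by positivity) (lt_min (by positivity) one_pos))
  have hη₀δ : η₀ ≤ δ / 4 := min_le_left _ _
  have hη₀a : η₀ ≤ a / 50 := (min_le_right _ _).trans (min_le_left _ _)
  have hη₀r : η₀ ≤ (r - ‖y‖) / 2 := ((min_le_right _ _).trans (min_le_right _ _)).trans (min_le_left _ _)
  have hη₀1 : η₀ ≤ 1 := ((min_le_right _ _).trans (min_le_right _ _)).trans (min_le_right _ _)
  set ηs : ℕ → ℝ := fun n => η₀ * (1 / ((n : ℝ) + 1)) with hηs_def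
  have hηs_pos : ∀ n, 0 < ηs n := fun n => by positivity
  have hηs_le : ∀ n, ηs n ≤ η₀ := fun n => by
    have h1 : 1 / ((n : ℝ) + 1) ≤ 1 := by
      rw [div_le_one (by positivity)]
      linarith [(Nat.cast_nonneg n : (0 : ℝ) ≤ n)]
    calc ηs n = η₀ * (1 / ((n : ℝ) + 1)) := rfl
      _ ≤ η₀ * 1 := by gcongr
      _ = η₀ := mul_one _
  have hεlim : Tendsto (fun n => 2 * ηs n / a) atTop (𝓝 0) := by
    have h := (tendsto_one_div_add_atTop_nhds_zero_nat).const_mul (2 * η₀ / a)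
    rw [mul_zero] at h
    refine h.congr fun n => ?_
    simp only [hηs_def]
    ring
  -- stage data at every `n`: an injective labelling of the limit shell by a pattern, for fcc or hcp
  have hstage : ∀ n : ℕ,
      (∃ (g : ↥fccKissingPattern → ↥hfinT.toFinset) (A : EuclideanSpace ℝ (Fin 3) →ₗᵢ[ℝ] (EuclideanSpace ℝ (Fin 3))), Function.Injective g ∧
        ∀ v, dist ((g v : ↥hfinT.toFinset) : EuclideanSpace ℝ (Fin 3)) (A v) ≤ 1 / 5 + 2 * ηs n / a) ∨
      (∃ (g : ↥hcpKissingPattern → ↥hfinT.toFinset) (A : EuclideanSpace ℝ (Fin 3) →ₗᵢ[ℝ] (EuclideanSpace ℝ (Fin 3))), Function.Injective g ∧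
        ∀ v, dist ((g v : ↥hfinT.toFinset) : EuclideanSpace ℝ (Fin 3)) (A v) ≤ 1 / 5 + 2 * ηs n / a) := by
    intro n
    obtain ⟨k, hmatch, hgk⟩ :=
      (((LocalConfig.tendsto_iff_locallyMatches.1 hY) (‖y‖ + 1 + 2 * a) (ηs n) (hηs_pos n)).and
        hgood).exists
    obtain ⟨p, hp, hyp⟩ := hmatch.2 y hy (by linarith)
    have hpn : ‖p‖ ≤ ‖y‖ + ηs n := by
      have h1 := norm_sub_norm_le p y
      rw [← dist_eq_norm, dist_comm] at h1
      linarith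
    have hclean : (({w ∈ (S k : Set (EuclideanSpace ℝ (Fin 3))) | w ≠ p ∧ dist p w ≤ a * (1 + 1 / 50)}.ncard = 12 ∧
          ∀ w ∈ (S k : Set (EuclideanSpace ℝ (Fin 3))), w ≠ p → a * (1 - 1 / 50) ≤ dist p w ∧
            (dist p w ≤ a * (1 + 1 / 50) ∨ a * (63 / 50) ≤ dist p w)) ∧
        (∃ T : Finset (EuclideanSpace ℝ (Fin 3)), (↑T : Set (EuclideanSpace ℝ (Fin 3))) =
            (fun w => a⁻¹ • (w - p)) '' {w ∈ (S k : Set (EuclideanSpace ℝ (Fin 3))) | w ≠ p ∧ dist p w ≤ a * (1 + 1 / 50)} ∧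
          (ShellCloseTo (1 / 5) T fccKissingPattern ∨ ShellCloseTo (1 / 5) T hcpKissingPattern))) := hgk p hp (by linarith [hηs_le n])
    obtain ⟨hgp, Tk, hTk, hclose⟩ := hclean
    have h2η : 2 * ηs n < δ := by linarith [hηs_le n]
    have h25 : 25 * ηs n < a := by linarith [hηs_le n]
    rcases hclose with hf | hh
    · exact Or.inl (cleR_stage_labelling ha hδ (hηs_pos n).le h2η h25 ((hηs_le n).trans hη₀1) (hS k)
        hmatch hp hyp le_rfl hgp hrad hT hTk hf)
    · exact Or.inr (cleR_stage_labelling ha hδ (hηs_pos n).le h2η h25 ((hηs_le n).trans hη₀1) (hS k)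
        hmatch hp hyp le_rfl hgp hrad hT hTk hh)
  -- one of the two patterns occurs frequently
  have hfreq : (∃ᶠ n in atTop, ∃ (g : ↥fccKissingPattern → ↥hfinT.toFinset) (A : EuclideanSpace ℝ (Fin 3) →ₗᵢ[ℝ] (EuclideanSpace ℝ (Fin 3))),
        Function.Injective g ∧ ∀ v, dist ((g v : ↥hfinT.toFinset) : EuclideanSpace ℝ (Fin 3)) (A v) ≤ 1 / 5 + 2 * ηs n / a) ∨
      (∃ᶠ n in atTop, ∃ (g : ↥hcpKissingPattern → ↥hfinT.toFinset) (A : EuclideanSpace ℝ (Fin 3) →ₗᵢ[ℝ] (EuclideanSpace ℝ (Fin 3))),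
        Function.Injective g ∧ ∀ v, dist ((g v : ↥hfinT.toFinset) : EuclideanSpace ℝ (Fin 3)) (A v) ≤ 1 / 5 + 2 * ηs n / a) := by
    by_contra hcon
    obtain ⟨h1, h2⟩ := not_or.1 hcon
    rw [not_frequently] at h1 h2
    obtain ⟨n, hn1, hn2⟩ := (h1.and h2).exists
    rcases hstage n with h | h
    · exact hn1 h
    · exact hn2 h
  rcases hfreq with h | h
  · exact Or.inl (cleR_shellCloseTo_of_frequently (by rw [hTcard, card_fccKissingPattern]) hεlim h)
  · exact Or.inr (cleR_shellCloseTo_of_frequently (by rw [hTcard, card_hcpKissingPattern]) hεlim h)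

end Summit.AtomisticToContinuum.Crystallization.Theorems

end
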